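import Summits.AtomisticToContinuum.Crystallization.Theorems.OverbindingBudgetRegistryDichotomyCW

/-!
# OverbindingBudget · decomp-a2c lens-4 g34 — part XXII: the slot-7 chain with the ENERGY binder carried (pinned-cell currency)

Helper file under `--supports stmt-AtomisticToContinuum-31280` (RDEF = `Theses.OverbindingBudget.RobustDefectLimitWindows`); closes nothing.

NODE «EnergyPinning», structural half (the energy cut itself is part XXII-B, `OverbindingBudgetEnergyPinningCut`).  The cut of record beneath
slot 7d (parts XX/XXI, cones `rdef_twentieth_of_recordK[_ref]`) pins the in-plane cell by STRESS: R4T `CellPinningT Λ₁ s₁ s₂` / R4S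
`CellPinningS Λ₁ t₁ t₂` read «zero in-plane virial ∧ zero gap stress ⇒ cell in the box».  Evaluating the in-plane virial of a configuration
needs its registry localised to first order — which R3 `RegistryLocalisationW` (hypothesis `Pinned`) and lens-3's kernel provide only AFTER
pinning: the stress route to R4 is circular at the typing level.  But the top seam of the whole slot-7 chain,
`OverbindingBudgetScaleWidening.layeredCleanOrStrained_of_balancedW`, HOLDS two binders it never passes down: `hU : Unstrained (Layered a b w)`
(no cube chunk beats the `#F`-particle ground-state energy by `κℓ³` — ENERGY-DENSITY OPTIMALITY) and the clean class's `9/10`-covering.  An off-box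
cell costs elastic energy `½·K·ε²` per particle at EVERY registry and height profile; optimality forbids it (part XXII-B types that certificate).

This file threads the two forgotten binders down the slot-7 chain in a new, uniformly WEAKER currency (suffix `U` = «+ `Unstrained` +
covering», suffix `P` = «+ the pinned-cell hypothesis `Pinned s₁ s₂ a b ∨ PinnedSq t₁ t₂ a b`»):
`BalancedLayeredCleanU Λ` ⟸ `StackedReductionW Λ Λ₁` ∧ `BalancedStackedCleanU Λ₁` ⟸ `GapStressVanishesW Λ₁` ∧ ★ `StackedCellPinningU Λ₁ s₁ s₂ t₁ t₂`
∧ `BasalGapRigidityP Λ₁ s₁ s₂ t₁ t₂` ⟸ 7c′ `TubeConvexW' Λ₁ ρ₀` (or 7c‴ `TubeConvexRef`) ∧ 7c″ `RegistryPinningW Λ₁ ρ₀ ρ₁` ∧ 7dP `BasalReferenceP Λ₁ ρ₁ …`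
(or 7d″P `BasalReferenceCP`) ⟸ the record's T{R3, Z∃, R5(⁺)} ∧ S{SqR3, SqR5(⁺)} WITHOUT R4T/R4S.  Every seam is PROVED (the record's proofs with
the binders carried); the top seam `layeredCleanOrStrained_of_balancedU` is PROVED for `T₀ ≤ 1/50` (`δ = 0.9212 − T₀ ≥ 9/10`); forgetful seams
from every record piece are PROVED (`…U_of_W`, `…P_of_W`, `…CP_of_CW`, `stackedCellPinningU_of_TS` — so cone XX ⟹ cone XXII).  Cones PROVED:
`rdef_of_grossU_shape_gluing_U` (XIII-U), `rdef_of_grossU_shape_gluing_stackedP` (XIV-P), XXII `rdef_of_grossU_shape_gluing_pinningU_convex{W',Ref}_registry`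
and the LEAF-CUT corollaries at the numbers of record `rdef_twentysecond_of_recordK[_ref]` = XX with R4T ∧ R4S ↦ ★ `StackedCellPinningU (17/16) s₁ s₂ t₁ t₂`.
-/

noncomputable section

namespace Summit.AtomisticToContinuum.Crystallization.Theorems.OverbindingBudgetEnergyPinning

open Metric
open scoped RealInnerProductSpace
open Literature.MathematicalPhysics.StatisticalMechanics (lennardJones groundStateEnergy)
open Summit.AtomisticToContinuum.Crystallization.Theses.OverbindingBudget (RobustDefectLimitWindows)
open Summit.AtomisticToContinuum.Crystallization.Theses.PricedLinkCensus (ChargedEnergyGap)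
open Summit.AtomisticToContinuum.Crystallization.Theorems.OverbindingBudgetGradedBareness (CleanlessExcessT)
open Summit.AtomisticToContinuum.Crystallization.Theorems.OverbindingBudgetCoherentCut (CoherentResidual)
open Summit.AtomisticToContinuum.Crystallization.Theorems.OverbindingBudgetUniformCutStatements (GrossCleanBallsU)
open Summit.AtomisticToContinuum.Crystallization.Theorems.OverbindingBudgetEdgeRelaxationStatements (CleanClass StrainedCubes)
open Summit.AtomisticToContinuum.Crystallization.Theorems.OverbindingBudgetElasticSplitStatements (SparseCharge LocallyOptimal VirialBalanced)
open Summit.AtomisticToContinuum.Crystallization.Theorems.OverbindingBudgetElasticSplitScale (HasCompressedScale CompressedVirialLaw)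
open Summit.AtomisticToContinuum.Crystallization.Theorems.OverbindingBudgetElasticSplitShear (StressFree)
open Summit.AtomisticToContinuum.Crystallization.Theorems.OverbindingBudgetElasticSplitPeriodic (Unstrained unstrained_or_strained
  virialBalanced_of_unstrained stressFree_of_unstrained rdef_of_grossU_periodicSplit)
open Summit.AtomisticToContinuum.Crystallization.Theorems.OverbindingBudgetLiouvilleDictionary (isNash_of_locallyOptimal)
open Summit.AtomisticToContinuum.Crystallization.Theorems.OverbindingBudgetTwoShellTransfer (sep_of_cleanClass)
open Summit.AtomisticToContinuum.Crystallization.Theorems.OverbindingBudgetLimitChargeFreeBall (limitChargeFreeBall_holds)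
open Summit.AtomisticToContinuum.Crystallization.Theorems.ChartedPlanarOrderChunkFloor (E3)
open Summit.AtomisticToContinuum.Crystallization.Theorems.ChartedPlanarOrderRigidityDoor (IsNash)
open Summit.AtomisticToContinuum.Crystallization.Theorems.ChartedPlanarOrderDensityDichotomy (μS IsSep)
open Summit.AtomisticToContinuum.Crystallization.Theorems.ChartedPlanarOrderDoorLayered (Layered)
open Summit.AtomisticToContinuum.Crystallization.Theorems.ChartedPlanarOrderProfileSlavingLJ (IsStacked gapStress incr tube
  translation_iff_incr_eq)
open Summit.AtomisticToContinuum.Crystallization.Theorems.ChartedPlanarOrderCleanScaleP (IsCleanP)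
open Summit.AtomisticToContinuum.Crystallization.Theorems.ChartedPlanarOrderStackedUniform (stackedUniform)
open Summit.AtomisticToContinuum.Crystallization.Theorems.ChartedPlanarOrderTubeConvex (TubeConvexW' TubeConvexRef
  tubeUniquenessW_of_tubeConvexW' tubeUniquenessRef_of_tubeConvexRef)
open Summit.AtomisticToContinuum.Crystallization.Theorems.OverbindingBudgetPeriodicCleanOrStrained (UniformlyClean LayeredCleanOrStrained
  periodicStrainedCubes_of_layered)
open Summit.AtomisticToContinuum.Crystallization.Theorems.OverbindingBudgetScaleWidening (IsCleanW CleanTwoShellW CleanChartedW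
  LocalTwoShellRigidityW DoorPeriodicW BalancedLayeredCleanW isCleanW_μS_iff cleanTwoShellW_of_ballPieces chargeFreeBallRigidityW_of_local
  optimalTexturePeriodic_of_doorPeriodicW)
open Summit.AtomisticToContinuum.Crystallization.Theorems.OverbindingBudgetTwoShellShape (TwoShellShape BarlowGluingW
  localTwoShellRigidityW_of_twoShellShape cleanChartedW_of_gluing)
open Summit.AtomisticToContinuum.Crystallization.Theorems.OverbindingBudgetStackedRigidityW (StackedReductionW GapStressVanishesW
  BasalGapRigidityW BasalReferenceW gapStress_const_of_indep uniformlyClean_translate layered_add_const)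
open Summit.AtomisticToContinuum.Crystallization.Theorems.OverbindingBudgetStackedRigidityRef (RegistryPinningW BasalReferenceCW
  isSep_of_uniformlyClean incr_mem_tube_symm)
open Summit.AtomisticToContinuum.Crystallization.Theorems.OverbindingBudgetStackedRigidityUniq (TubeUniquenessW TubeUniquenessRef)
open Summit.AtomisticToContinuum.Crystallization.Theorems.OverbindingBudgetRegistryCut (hol unifStress IsUnitNormal IsBalanced reg Pinned
  RegistryLocalisationW RegistryResidual RegistryTube RegistryMetric RegistryZeroExists isStacked_of_near_reg exists_profile_of_incr
  zeroExists_of_residual_tube)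
open Summit.AtomisticToContinuum.Crystallization.Theorems.OverbindingBudgetRegistrySquare (holSq IsSqBalanced regSq PinnedSq
  isStacked_of_near_regSq gapStress_regSq)
open Summit.AtomisticToContinuum.Crystallization.Theorems.OverbindingBudgetRegistryDichotomy (IsTType IsSType CellPinningT CellPinningS
  CellPinningDichotomyW RegistryGeometryW BalancedLocus SqRegistryLocalisationW SqRegistryGeometryW SqBalancedHeight SqRegistryMetric
  cellPinningDichotomyW_of_TS registryLocalisationW_of_geometry_locus sqRegistryLocalisationW_of_geometry_height)
open Summit.AtomisticToContinuum.Crystallization.Theorems.OverbindingBudgetRegistryDichotomyCW (RegistryMetricCW SqRegistryMetricCW)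

/-! ## §1 The slot-7 pieces with the forgotten binders (`U` = + `Unstrained` + covering; `P` = + pinned cell) -/

/-- **7-U · `BalancedLayeredCleanU Λ`** — `BalancedLayeredCleanW Λ` with the two binders the top seam holds anyway: energy-density optimality
`Unstrained (Layered a b w)` and the clean class's `9/10`-covering; separation binder `9/10 ≤ δ` (the seam has `δ = 0.9212 − T₀`).  WEAKER than
`BalancedLayeredCleanW Λ` (`balancedLayeredCleanU_of_W`). [piece] -/
def BalancedLayeredCleanU (Λ : ℝ) : Prop :=
  ∀ δ : ℝ, 9 / 10 ≤ δ → ∀ (a b : E3) (w : ℤ → E3), LinearIndependent ℝ ![a, b] → ‖a‖ ≤ Λ → ‖b‖ ≤ Λ →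
    IsSep δ (Layered a b w) → IsCleanW (μS (Layered a b w)) → IsNash (μS (Layered a b w)) →
    VirialBalanced (Layered a b w) → StressFree (Layered a b w) → Unstrained (Layered a b w) →
    (∀ z : E3, ∃ p ∈ Layered a b w, dist z p ≤ 9 / 10) → UniformlyClean (Layered a b w)

/-- **7-U, stacked · `BalancedStackedCleanU Λ₁`** — `BalancedStackedCleanW Λ₁` with the same two binders. [piece] -/
def BalancedStackedCleanU (Λ₁ : ℝ) : Prop :=
  ∀ δ : ℝ, 9 / 10 ≤ δ → ∀ (a b : E3) (w : ℤ → E3), IsStacked a b w → LinearIndependent ℝ ![a, b] →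
    ‖a‖ ≤ Λ₁ → ‖b‖ ≤ Λ₁ → IsSep δ (Layered a b w) → IsCleanW (μS (Layered a b w)) → IsNash (μS (Layered a b w)) →
    VirialBalanced (Layered a b w) → StressFree (Layered a b w) → Unstrained (Layered a b w) →
    (∀ z : E3, ∃ p ∈ Layered a b w, dist z p ≤ 9 / 10) → UniformlyClean (Layered a b w)

/-- ★ **7d-cell · `StackedCellPinningU Λ₁ s₁ s₂ t₁ t₂`** — THE RE-TYPED R4: an admissible stacked configuration (7d's binders verbatim, separation
`≥ 9/10`) that is moreover UNSTRAINED (energy-density optimal) and `9/10`-covering has a pinned near-triangular cell or a pinned near-square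
cell.  Fed by the record's R4T ∧ R4S (`stackedCellPinningU_of_TS`, forgetful) OR by the energy pieces of §4 (`stackedCellPinningU_of_energy`).
Why it might fail: only through the box widths — the energy margin `½Kε² − Δ_poly` must be positive at the box edge (isotropic `K ≈ 8.6`,
deviatoric `≈ 2`; `Δ_poly ≈ 10⁻⁴` at `e₁ = −0.7175`). [CERT·M via §4] [piece] -/
def StackedCellPinningU (Λ₁ s₁ s₂ t₁ t₂ : ℝ) : Prop :=
  ∀ δ : ℝ, 9 / 10 ≤ δ → ∀ (a b : E3) (w : ℤ → E3), IsStacked a b w → LinearIndependent ℝ ![a, b] →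
    ‖a‖ ≤ Λ₁ → ‖b‖ ≤ Λ₁ → IsSep δ (Layered a b w) → IsCleanW (μS (Layered a b w)) → IsNash (μS (Layered a b w)) →
    StressFree (Layered a b w) → (∀ m : ℤ, gapStress a b m (incr w) = 0) → Unstrained (Layered a b w) →
    (∀ z : E3, ∃ p ∈ Layered a b w, dist z p ≤ 9 / 10) → Pinned s₁ s₂ a b ∨ PinnedSq t₁ t₂ a b

/-- **7d♭-P · `BasalGapRigidityP Λ₁ s₁ s₂ t₁ t₂`** — `BasalGapRigidityW Λ₁` over a PINNED cell (T-box or S-box): zero stress across every gap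
forces uniform cleanliness.  WEAKER than `BasalGapRigidityW Λ₁`. [piece] -/
def BasalGapRigidityP (Λ₁ s₁ s₂ t₁ t₂ : ℝ) : Prop :=
  ∀ δ : ℝ, 0 < δ → ∀ (a b : E3) (w : ℤ → E3), IsStacked a b w → LinearIndependent ℝ ![a, b] →
    ‖a‖ ≤ Λ₁ → ‖b‖ ≤ Λ₁ → IsSep δ (Layered a b w) → IsCleanW (μS (Layered a b w)) → IsNash (μS (Layered a b w)) →
    StressFree (Layered a b w) → (∀ m : ℤ, gapStress a b m (incr w) = 0) → (Pinned s₁ s₂ a b ∨ PinnedSq t₁ t₂ a b) →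
    UniformlyClean (Layered a b w)

/-- **7dP · `BasalReferenceP Λ₁ η s₁ s₂ t₁ t₂`** — `BasalReferenceW Λ₁ η` over a pinned cell: a stacked, zero-gap-stress, uniformly clean
reference within `η` of the configuration, increment by increment.  WEAKER than `BasalReferenceW Λ₁ η`; fed by the record's registry pieces
WITHOUT R4 (`basalReferenceP_of_registry`). [piece] -/
def BasalReferenceP (Λ₁ η s₁ s₂ t₁ t₂ : ℝ) : Prop :=
  ∀ δ : ℝ, 0 < δ → ∀ (a b : E3) (w : ℤ → E3), IsStacked a b w → LinearIndependent ℝ ![a, b] →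
    ‖a‖ ≤ Λ₁ → ‖b‖ ≤ Λ₁ → IsSep δ (Layered a b w) → IsCleanW (μS (Layered a b w)) → IsNash (μS (Layered a b w)) →
    StressFree (Layered a b w) → (∀ m : ℤ, gapStress a b m (incr w) = 0) → (Pinned s₁ s₂ a b ∨ PinnedSq t₁ t₂ a b) →
    ∃ w' : ℤ → E3, IsStacked a b w' ∧ (∀ m : ℤ, incr w' m ∈ tube w η m) ∧ (∀ m : ℤ, gapStress a b m (incr w') = 0) ∧
      UniformlyClean (Layered a b w')

/-- **7d″P · `BasalReferenceCP Λ₁ η s₁ s₂ t₁ t₂`** — the reference-centred currency of record: `BasalReferenceCW Λ₁ η` over a pinned cell (the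
reference is also `IsCleanW`).  WEAKER than `BasalReferenceCW Λ₁ η`. [piece] -/
def BasalReferenceCP (Λ₁ η s₁ s₂ t₁ t₂ : ℝ) : Prop :=
  ∀ δ : ℝ, 0 < δ → ∀ (a b : E3) (w : ℤ → E3), IsStacked a b w → LinearIndependent ℝ ![a, b] →
    ‖a‖ ≤ Λ₁ → ‖b‖ ≤ Λ₁ → IsSep δ (Layered a b w) → IsCleanW (μS (Layered a b w)) → IsNash (μS (Layered a b w)) →
    StressFree (Layered a b w) → (∀ m : ℤ, gapStress a b m (incr w) = 0) → (Pinned s₁ s₂ a b ∨ PinnedSq t₁ t₂ a b) →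
    ∃ w' : ℤ → E3, IsStacked a b w' ∧ (∀ m : ℤ, incr w' m ∈ tube w η m) ∧ (∀ m : ℤ, gapStress a b m (incr w') = 0) ∧
      UniformlyClean (Layered a b w') ∧ IsCleanW (μS (Layered a b w'))

/-! ## §2 Forgetful seams (every record piece feeds its `U`/`P` twin) -/

/-- `BalancedLayeredCleanW Λ → BalancedLayeredCleanU Λ`. [this file] -/
theorem balancedLayeredCleanU_of_W {Λ : ℝ} (h : BalancedLayeredCleanW Λ) : BalancedLayeredCleanU Λ :=
  fun δ hδ a b w hab ha hb hs hc hn hv hf _ _ => h δ (by linarith) a b w hab ha hb hs hc hn hv hf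

/-- `BasalGapRigidityW Λ₁ → BasalGapRigidityP Λ₁ s₁ s₂ t₁ t₂`. [this file] -/
theorem basalGapRigidityP_of_W {Λ₁ s₁ s₂ t₁ t₂ : ℝ} (h : BasalGapRigidityW Λ₁) : BasalGapRigidityP Λ₁ s₁ s₂ t₁ t₂ :=
  fun δ hδ a b w hst hab ha hb hs hc hn hf hz _ => h δ hδ a b w hst hab ha hb hs hc hn hf hz

/-- `BasalReferenceW Λ₁ η → BasalReferenceP Λ₁ η s₁ s₂ t₁ t₂`. [this file] -/
theorem basalReferenceP_of_W {Λ₁ η s₁ s₂ t₁ t₂ : ℝ} (h : BasalReferenceW Λ₁ η) : BasalReferenceP Λ₁ η s₁ s₂ t₁ t₂ :=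
  fun δ hδ a b w hst hab ha hb hs hc hn hf hz _ => h δ hδ a b w hst hab ha hb hs hc hn hf hz

/-- `BasalReferenceCW Λ₁ η → BasalReferenceCP Λ₁ η s₁ s₂ t₁ t₂`. [this file] -/
theorem basalReferenceCP_of_CW {Λ₁ η s₁ s₂ t₁ t₂ : ℝ} (h : BasalReferenceCW Λ₁ η) : BasalReferenceCP Λ₁ η s₁ s₂ t₁ t₂ :=
  fun δ hδ a b w hst hab ha hb hs hc hn hf hz _ => h δ hδ a b w hst hab ha hb hs hc hn hf hz

/-- `CellPinningDichotomyW Λ₁ s₁ s₂ t₁ t₂ → StackedCellPinningU Λ₁ s₁ s₂ t₁ t₂` (forget `Unstrained` and covering). [this file] -/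
theorem stackedCellPinningU_of_dichotomyW {Λ₁ s₁ s₂ t₁ t₂ : ℝ} (h : CellPinningDichotomyW Λ₁ s₁ s₂ t₁ t₂) :
    StackedCellPinningU Λ₁ s₁ s₂ t₁ t₂ :=
  fun δ hδ a b w hst hab ha hb hs hc hn hf hz _ _ => h δ (by linarith) a b w hst hab ha hb hs hc hn hf hz

/-- ★ the record feeds the re-typed R4: `CellPinningT → CellPinningS → StackedCellPinningU` for `Λ₁ ≤ 17/16` (so cone XX ⟹ cone XXII). [this file] -/
theorem stackedCellPinningU_of_TS {Λ₁ s₁ s₂ t₁ t₂ : ℝ} (hΛ₁ : Λ₁ ≤ 17 / 16) (hT : CellPinningT Λ₁ s₁ s₂) (hS : CellPinningS Λ₁ t₁ t₂) :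
    StackedCellPinningU Λ₁ s₁ s₂ t₁ t₂ :=
  stackedCellPinningU_of_dichotomyW (cellPinningDichotomyW_of_TS hΛ₁ hT hS)

/-! ## §3 The chain seams, re-proved with the binders carried -/

/-- ★ **top seam (E_per, U currency).** `CleanTwoShellW T₀ D → BalancedLayeredCleanU Λ → LayeredCleanOrStrained Λ T₀ D` for `T₀ ≤ 1/50`: the record's
`layeredCleanOrStrained_of_balancedW` with `hU : Unstrained` and the clean class's covering PASSED DOWN instead of dropped
(`δ = 47/50·49/50 − T₀ ≥ 9/10`). [this file] -/
theorem layeredCleanOrStrained_of_balancedU {Λ T₀ D : ℝ} (hT : T₀ ≤ 1 / 50) (h₁ : CleanTwoShellW T₀ D) (hB : BalancedLayeredCleanU Λ) :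
    LayeredCleanOrStrained Λ T₀ D := by
  intro a b w hab ha hb hY hnc hsc hlo
  rcases unstrained_or_strained (Layered a b w) with hU | hS
  · left
    have hδ : (9 / 10 : ℝ) ≤ 47 / 50 * (49 / 50) - T₀ := by linarith
    exact hB _ hδ a b w hab ha hb (sep_of_cleanClass hY) ((isCleanW_μS_iff _).2 (h₁ _ hY hnc hsc hlo hU)) (isNash_of_locallyOptimal hlo)
      (virialBalanced_of_unstrained hU) (stressFree_of_unstrained hY.1 hU) hU hY.2.2.2.1
  · exact Or.inr hS

/-- **Seam, PROVED.** `GapStressVanishesW Λ₁ → StackedCellPinningU Λ₁ s₁ s₂ t₁ t₂ → BasalGapRigidityP Λ₁ s₁ s₂ t₁ t₂ → BalancedStackedCleanU Λ₁`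
(Nash balance from independence, part XVIII's `gapStress_const_of_indep`; the constant gap stress vanishes; the cell is pinned; rigidity over the
pinned cell). [this file] -/
theorem balancedStackedCleanU_of_pieces {Λ₁ s₁ s₂ t₁ t₂ : ℝ} (hV : GapStressVanishesW Λ₁) (hPin : StackedCellPinningU Λ₁ s₁ s₂ t₁ t₂)
    (hR : BasalGapRigidityP Λ₁ s₁ s₂ t₁ t₂) : BalancedStackedCleanU Λ₁ := by
  intro δ hδ a b w hst hab ha hb hsep hcl hna _hvb hsf hU hcov
  have hδ0 : (0 : ℝ) < δ := by linarith
  obtain ⟨σ, hσ⟩ := gapStress_const_of_indep hδ0 hab hst hsep hna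
  have hσ0 : σ = 0 := hV δ hδ0 a b w hst hab ha hb hsep hcl hna hsf σ hσ
  have hz : ∀ m : ℤ, gapStress a b m (incr w) = 0 := fun m => by rw [hσ m, hσ0]
  exact hR δ hδ0 a b w hst hab ha hb hsep hcl hna hsf hz (hPin δ hδ a b w hst hab ha hb hsep hcl hna hsf hz hU hcov)

/-- **Seam, PROVED.** `StackedReductionW Λ Λ₁ → BalancedStackedCleanU Λ₁ → BalancedLayeredCleanU Λ` (the re-representation has the same layered
set, so `Unstrained` and covering transport). [this file] -/
theorem balancedLayeredCleanU_of_stackedU {Λ Λ₁ : ℝ} (hSR : StackedReductionW Λ Λ₁) (hBS : BalancedStackedCleanU Λ₁) :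
    BalancedLayeredCleanU Λ := by
  intro δ hδ a b w hab ha hb hsep hcl hna hvb hsf hU hcov
  obtain ⟨a₁, b₁, w₁, hEq, hst, hab₁, ha₁, hb₁⟩ := hSR δ (by linarith) a b w hab ha hb hsep hcl hna hvb hsf
  have h := hBS δ hδ a₁ b₁ w₁ hst hab₁ ha₁ hb₁ (hEq ▸ hsep) (hEq ▸ hcl) (hEq ▸ hna) (hEq ▸ hvb) (hEq ▸ hsf) (hEq ▸ hU) (hEq ▸ hcov)
  rwa [hEq] at h

/-- `StackedReductionW Λ Λ₁ → GapStressVanishesW Λ₁ → StackedCellPinningU Λ₁ … → BasalGapRigidityP Λ₁ … → BalancedLayeredCleanU Λ`. [this file] -/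
theorem balancedLayeredCleanU_of_basalP {Λ Λ₁ s₁ s₂ t₁ t₂ : ℝ} (hSR : StackedReductionW Λ Λ₁) (hV : GapStressVanishesW Λ₁)
    (hPin : StackedCellPinningU Λ₁ s₁ s₂ t₁ t₂) (hR : BasalGapRigidityP Λ₁ s₁ s₂ t₁ t₂) : BalancedLayeredCleanU Λ :=
  balancedLayeredCleanU_of_stackedU hSR (balancedStackedCleanU_of_pieces hV hPin hR)

/-- **Seam, PROVED.** `TubeUniquenessW Λ₁ ρ → BasalReferenceP Λ₁ ρ … → BasalGapRigidityP Λ₁ …` (part XIX-U's proof: the reference in the tube has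
the configuration's increments, so the configuration is a translate of it). [this file] -/
theorem basalGapRigidityP_of_uniq {Λ₁ ρ s₁ s₂ t₁ t₂ : ℝ} (hU : TubeUniquenessW Λ₁ ρ) (hR : BasalReferenceP Λ₁ ρ s₁ s₂ t₁ t₂) :
    BasalGapRigidityP Λ₁ s₁ s₂ t₁ t₂ := by
  intro δ hδ a b w hst hab ha hb hsep hcl hna hsf hzero hp
  obtain ⟨w', hst', htube, hzero', hUC⟩ := hR δ hδ a b w hst hab ha hb hsep hcl hna hsf hzero hp
  have hincr : incr w' = incr w := hU δ hδ a b w hst hab ha hb hsep hcl hna hsf hzero w' hst' htube hzero'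
  obtain ⟨c, hc⟩ := (translation_iff_incr_eq w' w).mpr fun m => by rw [hincr]
  have hw : w = fun m => w' m + c := funext hc
  rw [hw, layered_add_const]
  exact uniformlyClean_translate (-c) hUC

/-- **Seam, PROVED (currency of record).** `TubeUniquenessRef Λ₁ ρ → BasalReferenceCP Λ₁ ρ … → BasalGapRigidityP Λ₁ …`. [this file] -/
theorem basalGapRigidityP_of_uniqRef {Λ₁ ρ s₁ s₂ t₁ t₂ : ℝ} (hU : TubeUniquenessRef Λ₁ ρ) (hR : BasalReferenceCP Λ₁ ρ s₁ s₂ t₁ t₂) :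
    BasalGapRigidityP Λ₁ s₁ s₂ t₁ t₂ := by
  intro δ hδ a b w hst hab ha hb hsep hcl hna hsf hzero hp
  obtain ⟨w', hst', htube, hzero', hUC, hcl'⟩ := hR δ hδ a b w hst hab ha hb hsep hcl hna hsf hzero hp
  have hincr : incr w = incr w' :=
    hU (9 / 10) (by norm_num) a b w' hst' hab ha hb (isSep_of_uniformlyClean hUC) hcl' hzero' hUC w hst
      (fun m => incr_mem_tube_symm (htube m)) hzero
  obtain ⟨c, hc⟩ := (translation_iff_incr_eq w' w).mpr fun m => by rw [hincr]
  have hw : w = fun m => w' m + c := funext hc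
  rw [hw, layered_add_const]
  exact uniformlyClean_translate (-c) hUC

/-- **Seam, PROVED.** Annulus exclusion over a pinned cell: `BasalReferenceP Λ₁ ρ₁ … → RegistryPinningW Λ₁ ρ₀ ρ₁ → BasalReferenceP Λ₁ ρ₀ …`. [this file] -/
theorem basalReferenceP_of_pinning {Λ₁ ρ₀ ρ₁ s₁ s₂ t₁ t₂ : ℝ} (hR : BasalReferenceP Λ₁ ρ₁ s₁ s₂ t₁ t₂) (hP : RegistryPinningW Λ₁ ρ₀ ρ₁) :
    BasalReferenceP Λ₁ ρ₀ s₁ s₂ t₁ t₂ := by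
  intro δ hδ a b w hst hab ha hb hs hc hn hf hz hp
  obtain ⟨w', hst', htube, hz', hUC⟩ := hR δ hδ a b w hst hab ha hb hs hc hn hf hz hp
  exact ⟨w', hst', hP δ hδ a b w hst hab ha hb hs hc hn hf hz w' hst' hz' hUC htube, hz', hUC⟩

/-- **Seam, PROVED (currency of record).** `BasalReferenceCP Λ₁ ρ₁ … → RegistryPinningW Λ₁ ρ₀ ρ₁ → BasalReferenceCP Λ₁ ρ₀ …`. [this file] -/
theorem basalReferenceCP_of_pinning {Λ₁ ρ₀ ρ₁ s₁ s₂ t₁ t₂ : ℝ} (hR : BasalReferenceCP Λ₁ ρ₁ s₁ s₂ t₁ t₂) (hP : RegistryPinningW Λ₁ ρ₀ ρ₁) :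
    BasalReferenceCP Λ₁ ρ₀ s₁ s₂ t₁ t₂ := by
  intro δ hδ a b w hst hab ha hb hs hc hn hf hz hp
  obtain ⟨w', hst', htube, hz', hUC, hc'⟩ := hR δ hδ a b w hst hab ha hb hs hc hn hf hz hp
  exact ⟨w', hst', hP δ hδ a b w hst hab ha hb hs hc hn hf hz w' hst' hz' hUC htube, hz', hUC, hc'⟩

/-- ★ **7dP from the registry pieces WITHOUT R4** (part XXI-D's `basalReferenceW_of_dichotomy` with the dichotomy taken as the hypothesis):
`RegistryLocalisationW r′ → RegistryZeroExists r″ → RegistryMetric r″ → SqRegistryLocalisationW h₁ τ rₛ → SqRegistryMetric h₁ τ rₛ″ →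
BasalReferenceP Λ₁ ρ₁ s₁ s₂ t₁ t₂` for `r″ < 1/2`, `r′ + r″ ≤ ρ₁`, `0 ≤ rₛ″`, `rₛ ≤ ρ₁`. [this file] -/
theorem basalReferenceP_of_registry {Λ₁ s₁ s₂ t₁ t₂ r' r'' h₁ τ rₛ rₛ'' ρ₁ : ℝ} (hr'' : r'' < 1 / 2) (hρ₁ : r' + r'' ≤ ρ₁) (hrₛ'' : 0 ≤ rₛ'')
    (hrₛ : rₛ ≤ ρ₁) (hLoc : RegistryLocalisationW Λ₁ s₁ s₂ r') (hEx : RegistryZeroExists s₁ s₂ r'') (hMet : RegistryMetric s₁ s₂ r'')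
    (hSqLoc : SqRegistryLocalisationW Λ₁ t₁ t₂ h₁ τ rₛ) (hSqMet : SqRegistryMetric t₁ t₂ h₁ τ rₛ'') : BasalReferenceP Λ₁ ρ₁ s₁ s₂ t₁ t₂ := by
  intro δ hδ a b w hst hab ha hb hs hc hna hf hz hp
  rcases hp with hp | hp
  · obtain ⟨n, c, σ, u, v, hn, hbal, hloc⟩ := hLoc δ hδ a b w hst hab ha hb hs hc hna hf hz hp
    obtain ⟨h, hh, hz'⟩ := hEx a b n c σ u v hp hn hbal
    obtain ⟨w', hw'⟩ := exists_profile_of_incr h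
    have hh' : ∀ k, ‖incr w' k - reg a b n c σ u v k‖ ≤ r'' := fun k => by rw [hw']; exact hh k
    refine ⟨w', isStacked_of_near_reg hn hbal.1 hh' hr'', fun m => ?_, fun m => by rw [hw']; exact hz' m,
      hMet a b n c σ u v hp hn hbal w' hh'⟩
    rw [tube, mem_closedBall, dist_eq_norm]
    calc ‖incr w' m - incr w m‖ ≤ ‖incr w' m - reg a b n c σ u v m‖ + ‖incr w m - reg a b n c σ u v m‖ := by
          rw [← norm_neg (incr w m - reg a b n c σ u v m), neg_sub]
          exact norm_sub_le_norm_sub_add_norm_sub _ _ _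
      _ ≤ r'' + r' := add_le_add (hh' m) (hloc m)
      _ ≤ ρ₁ := by linarith
  · obtain ⟨n, c, u, v, hn, hbal, hhgt, hloc⟩ := hSqLoc δ hδ a b w hst hab ha hb hs hc hna hf hz hp
    obtain ⟨w', hw'⟩ := exists_profile_of_incr (regSq a b c u v)
    have h0 : ∀ k, ‖incr w' k - regSq a b c u v k‖ ≤ 0 := fun k => by rw [hw', sub_self, norm_zero]
    refine ⟨w', isStacked_of_near_regSq hn hbal.1 h0 one_half_pos, fun m => ?_, fun m => by rw [hw', gapStress_regSq]; exact hbal.2.2,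
      hSqMet a b n c u v hp hn hbal.2.1 hhgt w' fun k => (h0 k).trans hrₛ''⟩
    rw [tube, mem_closedBall, dist_eq_norm, hw', ← norm_neg, neg_sub]
    exact (hloc m).trans hrₛ

/-- ★ **7d″P from the registry pieces WITHOUT R4, currency of record** (part XXI-R's `basalReferenceCW_of_dichotomy`, same change):
`RegistryLocalisationW r′ → RegistryZeroExists r″ → RegistryMetricCW r″ → SqRegistryLocalisationW h₁ τ rₛ → SqRegistryMetricCW h₁ τ rₛ″ →
BasalReferenceCP Λ₁ ρ₁ s₁ s₂ t₁ t₂`. [this file] -/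
theorem basalReferenceCP_of_registry {Λ₁ s₁ s₂ t₁ t₂ r' r'' h₁ τ rₛ rₛ'' ρ₁ : ℝ} (hr'' : r'' < 1 / 2) (hρ₁ : r' + r'' ≤ ρ₁) (hrₛ'' : 0 ≤ rₛ'')
    (hrₛ : rₛ ≤ ρ₁) (hLoc : RegistryLocalisationW Λ₁ s₁ s₂ r') (hEx : RegistryZeroExists s₁ s₂ r'') (hMet : RegistryMetricCW s₁ s₂ r'')
    (hSqLoc : SqRegistryLocalisationW Λ₁ t₁ t₂ h₁ τ rₛ) (hSqMet : SqRegistryMetricCW t₁ t₂ h₁ τ rₛ'') :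
    BasalReferenceCP Λ₁ ρ₁ s₁ s₂ t₁ t₂ := by
  intro δ hδ a b w hst hab ha hb hs hc hna hf hz hp
  rcases hp with hp | hp
  · obtain ⟨n, c, σ, u, v, hn, hbal, hloc⟩ := hLoc δ hδ a b w hst hab ha hb hs hc hna hf hz hp
    obtain ⟨h, hh, hz'⟩ := hEx a b n c σ u v hp hn hbal
    obtain ⟨w', hw'⟩ := exists_profile_of_incr h
    have hh' : ∀ k, ‖incr w' k - reg a b n c σ u v k‖ ≤ r'' := fun k => by rw [hw']; exact hh k
    refine ⟨w', isStacked_of_near_reg hn hbal.1 hh' hr'', fun m => ?_, fun m => by rw [hw']; exact hz' m,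
      (hMet a b n c σ u v hp hn hbal w' hh').1, (hMet a b n c σ u v hp hn hbal w' hh').2⟩
    rw [tube, mem_closedBall, dist_eq_norm]
    calc ‖incr w' m - incr w m‖ ≤ ‖incr w' m - reg a b n c σ u v m‖ + ‖incr w m - reg a b n c σ u v m‖ := by
          rw [← norm_neg (incr w m - reg a b n c σ u v m), neg_sub]
          exact norm_sub_le_norm_sub_add_norm_sub _ _ _
      _ ≤ r'' + r' := add_le_add (hh' m) (hloc m)
      _ ≤ ρ₁ := by linarith
  · obtain ⟨n, c, u, v, hn, hbal, hhgt, hloc⟩ := hSqLoc δ hδ a b w hst hab ha hb hs hc hna hf hz hp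
    obtain ⟨w', hw'⟩ := exists_profile_of_incr (regSq a b c u v)
    have h0 : ∀ k, ‖incr w' k - regSq a b c u v k‖ ≤ 0 := fun k => by rw [hw', sub_self, norm_zero]
    have hcl := hSqMet a b n c u v hp hn hbal.2.1 hhgt w' fun k => (h0 k).trans hrₛ''
    refine ⟨w', isStacked_of_near_regSq hn hbal.1 h0 one_half_pos, fun m => ?_, fun m => by rw [hw', gapStress_regSq]; exact hbal.2.2,
      hcl.1, hcl.2⟩
    rw [tube, mem_closedBall, dist_eq_norm, hw', ← norm_neg, neg_sub]
    exact (hloc m).trans hrₛ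

/-! ## §5 The cones -/

/-- RDEF cone, thirteenth form in U currency, slot 4 entered at `LocalTwoShellRigidityW` (the record's proof with the U top seam). [this file] -/
theorem rdef_of_grossU_localW_doorPeriodicW_balancedU (Λ : ℝ) (hG : GrossCleanBallsU (1 / 250) 10) (hCEG : ChargedEnergyGap)
    (hC : CompressedVirialLaw (1 / 250) 10) (hL : LocalTwoShellRigidityW (1 / 250) 10) (h₂ : CleanChartedW (1 / 250) 10)
    (hD : DoorPeriodicW Λ) (hB : BalancedLayeredCleanU Λ) (hCE : CleanlessExcessT) (hR : CoherentResidual 10) :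
    RobustDefectLimitWindows :=
  have h₁ : CleanTwoShellW (1 / 250) 10 :=
    cleanTwoShellW_of_ballPieces (limitChargeFreeBall_holds (1 / 250) 10) (chargeFreeBallRigidityW_of_local (by norm_num) hL)
  rdef_of_grossU_periodicSplit Λ hG hCEG hC (optimalTexturePeriodic_of_doorPeriodicW h₁ h₂ hD)
    (periodicStrainedCubes_of_layered (by norm_num) (layeredCleanOrStrained_of_balancedU (by norm_num) h₁ hB)) hCE hR

/-- **RDEF cone, THIRTEENTH form in U currency** (every `Λ`): `… → BalancedLayeredCleanU Λ → … → RobustDefectLimitWindows`. [this file] -/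
theorem rdef_of_grossU_shape_gluing_U (Λ : ℝ) (hG : GrossCleanBallsU (1 / 250) 10) (hCEG : ChargedEnergyGap)
    (hC : CompressedVirialLaw (1 / 250) 10) (hS : TwoShellShape (1 / 100) (3 / 50) (1 / 450)) (hB₂ : BarlowGluingW) (hD : DoorPeriodicW Λ)
    (hB : BalancedLayeredCleanU Λ) (hCE : CleanlessExcessT) (hR : CoherentResidual 10) : RobustDefectLimitWindows :=
  rdef_of_grossU_localW_doorPeriodicW_balancedU Λ hG hCEG hC (localTwoShellRigidityW_of_twoShellShape (by norm_num) hS)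
    (cleanChartedW_of_gluing hB₂) hD hB hCE hR

/-- **RDEF cone, FOURTEENTH form in P currency** (every `Λ Λ₁ s₁ s₂ t₁ t₂`): slot 7 := `StackedReductionW Λ Λ₁` ∧ `GapStressVanishesW Λ₁` ∧
★ `StackedCellPinningU Λ₁ s₁ s₂ t₁ t₂` ∧ `BasalGapRigidityP Λ₁ s₁ s₂ t₁ t₂`. [this file] -/
theorem rdef_of_grossU_shape_gluing_stackedP (Λ Λ₁ s₁ s₂ t₁ t₂ : ℝ) (hG : GrossCleanBallsU (1 / 250) 10) (hCEG : ChargedEnergyGap)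
    (hC : CompressedVirialLaw (1 / 250) 10) (hS : TwoShellShape (1 / 100) (3 / 50) (1 / 450)) (hB₂ : BarlowGluingW) (hD : DoorPeriodicW Λ)
    (hSR : StackedReductionW Λ Λ₁) (hV : GapStressVanishesW Λ₁) (hPin : StackedCellPinningU Λ₁ s₁ s₂ t₁ t₂)
    (hR : BasalGapRigidityP Λ₁ s₁ s₂ t₁ t₂) (hCE : CleanlessExcessT) (hRes : CoherentResidual 10) : RobustDefectLimitWindows :=
  rdef_of_grossU_shape_gluing_U Λ hG hCEG hC hS hB₂ hD (balancedLayeredCleanU_of_basalP hSR hV hPin hR) hCE hRes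

/-- ★ **RDEF cone, TWENTY-SECOND form** (every `Λ Λ₁ ρ₀ ρ₁ s₁ s₂ t₁ t₂ r′ r″ h₁ τ rₛ rₛ″` with `r″ < 1/2`, `r′ + r″ ≤ ρ₁`, `0 ≤ rₛ″`, `rₛ ≤ ρ₁`; W′ currency,
7c′ := lens-3's `TubeConvexW' Λ₁ ρ₀`): cone XX with R4T ∧ R4S replaced by ★ `StackedCellPinningU Λ₁ s₁ s₂ t₁ t₂`, 7c′/7c″/T{R3, Z∃, R5}/S{SqR3, SqR5}
feeding 7dP over the pinned cell. [this file] -/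
theorem rdef_of_grossU_shape_gluing_pinningU_convexW'_registry (Λ Λ₁ ρ₀ ρ₁ s₁ s₂ t₁ t₂ r' r'' h₁ τ rₛ rₛ'' : ℝ) (hr'' : r'' < 1 / 2)
    (hρ₁ : r' + r'' ≤ ρ₁) (hrₛ'' : 0 ≤ rₛ'') (hrₛ : rₛ ≤ ρ₁)
    (hG : GrossCleanBallsU (1 / 250) 10) (hCEG : ChargedEnergyGap) (hC : CompressedVirialLaw (1 / 250) 10)
    (hS : TwoShellShape (1 / 100) (3 / 50) (1 / 450)) (hB₂ : BarlowGluingW) (hD : DoorPeriodicW Λ) (hSR : StackedReductionW Λ Λ₁)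
    (hV : GapStressVanishesW Λ₁) (hP : RegistryPinningW Λ₁ ρ₀ ρ₁) (hT : TubeConvexW' Λ₁ ρ₀) (hPin : StackedCellPinningU Λ₁ s₁ s₂ t₁ t₂)
    (hLoc : RegistryLocalisationW Λ₁ s₁ s₂ r') (hEx : RegistryZeroExists s₁ s₂ r'') (hMet : RegistryMetric s₁ s₂ r'')
    (hSqLoc : SqRegistryLocalisationW Λ₁ t₁ t₂ h₁ τ rₛ) (hSqMet : SqRegistryMetric t₁ t₂ h₁ τ rₛ'')
    (hCE : CleanlessExcessT) (hRes : CoherentResidual 10) : RobustDefectLimitWindows :=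
  rdef_of_grossU_shape_gluing_stackedP Λ Λ₁ s₁ s₂ t₁ t₂ hG hCEG hC hS hB₂ hD hSR hV hPin
    (basalGapRigidityP_of_uniq (tubeUniquenessW_of_tubeConvexW' hT)
      (basalReferenceP_of_pinning (basalReferenceP_of_registry hr'' hρ₁ hrₛ'' hrₛ hLoc hEx hMet hSqLoc hSqMet) hP)) hCE hRes

/-- ★ **RDEF cone, twenty-second form, reference-centred (CURRENCY OF RECORD)** (7c‴ := lens-3's `TubeConvexRef Λ₁ ρ₀`; 7d″P fed by
T{R3, Z∃, R5⁺}/S{SqR3, SqR5⁺}). [this file] -/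
theorem rdef_of_grossU_shape_gluing_pinningU_convexRef_registry (Λ Λ₁ ρ₀ ρ₁ s₁ s₂ t₁ t₂ r' r'' h₁ τ rₛ rₛ'' : ℝ) (hr'' : r'' < 1 / 2)
    (hρ₁ : r' + r'' ≤ ρ₁) (hrₛ'' : 0 ≤ rₛ'') (hrₛ : rₛ ≤ ρ₁)
    (hG : GrossCleanBallsU (1 / 250) 10) (hCEG : ChargedEnergyGap) (hC : CompressedVirialLaw (1 / 250) 10)
    (hS : TwoShellShape (1 / 100) (3 / 50) (1 / 450)) (hB₂ : BarlowGluingW) (hD : DoorPeriodicW Λ) (hSR : StackedReductionW Λ Λ₁)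
    (hV : GapStressVanishesW Λ₁) (hP : RegistryPinningW Λ₁ ρ₀ ρ₁) (hT : TubeConvexRef Λ₁ ρ₀) (hPin : StackedCellPinningU Λ₁ s₁ s₂ t₁ t₂)
    (hLoc : RegistryLocalisationW Λ₁ s₁ s₂ r') (hEx : RegistryZeroExists s₁ s₂ r'') (hMet : RegistryMetricCW s₁ s₂ r'')
    (hSqLoc : SqRegistryLocalisationW Λ₁ t₁ t₂ h₁ τ rₛ) (hSqMet : SqRegistryMetricCW t₁ t₂ h₁ τ rₛ'')
    (hCE : CleanlessExcessT) (hRes : CoherentResidual 10) : RobustDefectLimitWindows :=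
  rdef_of_grossU_shape_gluing_stackedP Λ Λ₁ s₁ s₂ t₁ t₂ hG hCEG hC hS hB₂ hD hSR hV hPin
    (basalGapRigidityP_of_uniqRef (tubeUniquenessRef_of_tubeConvexRef hT)
      (basalReferenceCP_of_pinning (basalReferenceCP_of_registry hr'' hρ₁ hrₛ'' hrₛ hLoc hEx hMet hSqLoc hSqMet) hP)) hCE hRes

/-- ★ **the twenty-second cone AT THE NUMBERS OF RECORD, LEAF-CUT** (W′ currency; `(Λ, Λ₁; ρ₀, ρ₁) = (2, 17/16; 1/40, 3/16)`; kernel currency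
`(ε, r, μ; r″) = (1/250, 1/100, 1; 3/500)`; T `(τ₀, τ) = (3/20, 1/40)`; S `(τ₀, τ, rₛ, rₛ″) = (3/20, 1/100, 4/25, 0)`; boxes and central heights
SYMBOLIC).  Leaves: slots 1–6, 7a, 7b, 7c″, 7c′ `TubeConvexW'` and, for 7d, ★ `StackedCellPinningU (17/16) s₁ s₂ t₁ t₂` ∧ R3geo ∧ `BalancedLocus`
∧ R1 ∧ R2 ∧ R5 ∧ SqR3geo ∧ `SqBalancedHeight` ∧ SqR5; slots 8, 9. [this file] -/
theorem rdef_twentysecond_of_recordK (s₁ s₂ t₁ t₂ h₀ h₁ : ℝ) (hG : GrossCleanBallsU (1 / 250) 10) (hCEG : ChargedEnergyGap)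
    (hC : CompressedVirialLaw (1 / 250) 10) (hS : TwoShellShape (1 / 100) (3 / 50) (1 / 450)) (hB₂ : BarlowGluingW) (hD : DoorPeriodicW 2)
    (hSR : StackedReductionW 2 (17 / 16)) (hV : GapStressVanishesW (17 / 16)) (hP : RegistryPinningW (17 / 16) (1 / 40) (3 / 16))
    (hT : TubeConvexW' (17 / 16) (1 / 40)) (hPin : StackedCellPinningU (17 / 16) s₁ s₂ t₁ t₂)
    (hGeo : RegistryGeometryW (17 / 16) s₁ s₂ h₀ (3 / 20)) (hBal : BalancedLocus s₁ s₂ h₀ (1 / 40)) (hR1 : RegistryResidual s₁ s₂ (1 / 250))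
    (hR2 : RegistryTube s₁ s₂ (1 / 100) 1) (hMet : RegistryMetric s₁ s₂ (3 / 500)) (hSqGeo : SqRegistryGeometryW (17 / 16) t₁ t₂ h₁ (3 / 20))
    (hSqH : SqBalancedHeight t₁ t₂ h₁ (1 / 100)) (hSqMet : SqRegistryMetric t₁ t₂ h₁ (1 / 100) 0) (hCE : CleanlessExcessT)
    (hRes : CoherentResidual 10) : RobustDefectLimitWindows :=
  rdef_of_grossU_shape_gluing_pinningU_convexW'_registry 2 (17 / 16) (1 / 40) (3 / 16) s₁ s₂ t₁ t₂ (7 / 40) (3 / 500) h₁ (1 / 100) (4 / 25) 0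
    (by norm_num) (by norm_num) le_rfl (by norm_num) hG hCEG hC hS hB₂ hD hSR hV hP hT hPin
    (registryLocalisationW_of_geometry_locus (by norm_num) hGeo hBal)
    (zeroExists_of_residual_tube (by norm_num) (by norm_num) (by norm_num) (by norm_num) (by norm_num) (by norm_num) hR1 hR2) hMet
    (sqRegistryLocalisationW_of_geometry_height (by norm_num) hSqGeo hSqH) hSqMet hCE hRes

/-- ★ **the twenty-second cone at the numbers of record, reference-centred (CURRENCY OF RECORD), LEAF-CUT** (7c‴ := `TubeConvexRef (17/16) (1/40)`;
R5⁺ / SqR5⁺).  Leaves: slots 1–6, 7a, 7b, 7c″, 7c‴ and, for 7d″, ★ `StackedCellPinningU (17/16) s₁ s₂ t₁ t₂` ∧ R3geo ∧ `BalancedLocus` ∧ R1 ∧ R2 ∧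
R5⁺ ∧ SqR3geo ∧ `SqBalancedHeight` ∧ SqR5⁺; slots 8, 9. [this file] -/
theorem rdef_twentysecond_of_recordK_ref (s₁ s₂ t₁ t₂ h₀ h₁ : ℝ) (hG : GrossCleanBallsU (1 / 250) 10) (hCEG : ChargedEnergyGap)
    (hC : CompressedVirialLaw (1 / 250) 10) (hS : TwoShellShape (1 / 100) (3 / 50) (1 / 450)) (hB₂ : BarlowGluingW) (hD : DoorPeriodicW 2)
    (hSR : StackedReductionW 2 (17 / 16)) (hV : GapStressVanishesW (17 / 16)) (hP : RegistryPinningW (17 / 16) (1 / 40) (3 / 16))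
    (hT : TubeConvexRef (17 / 16) (1 / 40)) (hPin : StackedCellPinningU (17 / 16) s₁ s₂ t₁ t₂)
    (hGeo : RegistryGeometryW (17 / 16) s₁ s₂ h₀ (3 / 20)) (hBal : BalancedLocus s₁ s₂ h₀ (1 / 40)) (hR1 : RegistryResidual s₁ s₂ (1 / 250))
    (hR2 : RegistryTube s₁ s₂ (1 / 100) 1) (hMet : RegistryMetricCW s₁ s₂ (3 / 500))
    (hSqGeo : SqRegistryGeometryW (17 / 16) t₁ t₂ h₁ (3 / 20)) (hSqH : SqBalancedHeight t₁ t₂ h₁ (1 / 100))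
    (hSqMet : SqRegistryMetricCW t₁ t₂ h₁ (1 / 100) 0) (hCE : CleanlessExcessT) (hRes : CoherentResidual 10) : RobustDefectLimitWindows :=
  rdef_of_grossU_shape_gluing_pinningU_convexRef_registry 2 (17 / 16) (1 / 40) (3 / 16) s₁ s₂ t₁ t₂ (7 / 40) (3 / 500) h₁ (1 / 100) (4 / 25) 0
    (by norm_num) (by norm_num) le_rfl (by norm_num) hG hCEG hC hS hB₂ hD hSR hV hP hT hPin
    (registryLocalisationW_of_geometry_locus (by norm_num) hGeo hBal)
    (zeroExists_of_residual_tube (by norm_num) (by norm_num) (by norm_num) (by norm_num) (by norm_num) (by norm_num) hR1 hR2) hMet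
    (sqRegistryLocalisationW_of_geometry_height (by norm_num) hSqGeo hSqH) hSqMet hCE hRes

end Summit.AtomisticToContinuum.Crystallization.Theorems.OverbindingBudgetEnergyPinning

end
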